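/-
Copyright (c) 2026 the pub-hodgecm-mathlib formalisation cell (harness21).  Prover seat hodgecm-mathlib-LH4-p04 (g5), Track A «(D-RAM) FOUR-FRAME», unit U2H, the census leaf
(ρ2b′-X) `stub_U2H_fixedPointCensus_typeTwo_unit0` — socket (C) (type RamM bottom, dealer WORD #30: lead LH4-p04 + LH4-p06), organ (C-5a) «TOKEN LETTERS, TYPE RamM»: the depth
dictionary `|λ − ι u₀| = exp(−2m)` under `|ι x| = |x|²`, and the two spellings of the T5s-RamM tokens.  2026-09-04.
-/
import Summits.HodgeConjecture.HodgeConjecture.Theorems.F0P3cDyRamTypeTwoDepthDictionary   -- ★ p858045 (LH4-p11 (g5)): `map_quadratic_eq_mul`, `eq_exp_neg_of_mul_self_eq` (type-free)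
import Literature.NumberTheory.Automorphic.UnitaryThreeFourFrameDefs                         -- D `IsRamifiedQuadraticDatum`
import HarnessLib

/-!
# F0 · P3c · line LH4 «(D-RAM) FOUR-FRAME» — leaf (ρ2b′-X), socket (C) type RamM, organ (C-5a): TOKEN LETTERS (Rogawski 1990 §4.9; Serre 1979 Ch. II §2)

Cell `pub/hodgecm-mathlib` (D-0151), crux H413 = `stmt-HodgeConjecture-24833` (helper lane `--supports stmt-HodgeConjecture-24833 --as helper`, count-neutral); THEOREMS ONLY (no
definition, no instance, no notation, no named fact, no `sorry`, default heartbeats).  Socket served: the typed order-count socket (C) `SOCKET-hOCC.v1` 869d0c15 (payer LH4-p14, MAP v3).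

The (C) bottom binds the plane token `m` through the socket's clause `|χ_{γ₂}(γ)|_w = |ι_v ϖ_v|_w^m`, i.e. — once `|ι_v ϖ_v|_w = exp(−2)` (ramified `w ∣ v`) and `χ_{γ₂}(γ)_w =
u₀² − t·u₀ + D` are read (the (A)-shared letters of LH4-p11∕LH4-p07) — `|u₀² − t·u₀ + D|_w = exp(−2m)`.  On the RamM line `M = E′_{w₁}` the embedding `ι = ι_{w₁}` DOUBLES orders
(`|ι x| = |x|²`, ★ p857979 type C), so the type-U dictionary ★ p858045 `v_sub_eq_exp_neg_of_token` (which binds an isometric `ι`) does not apply verbatim.  THIS FILE: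
* §1 **`v_sub_eq_exp_of_token_ramM`** — `|λ − ι u₀| = exp(−2m)` from `|u₀² − t·u₀ + D| = exp(−2m)` and `|ι x| = |x|²` (`ι(u₀² − tu₀ + D) = (ιu₀ − λ)(ιu₀ − ρλ)`, ★ p858045
  `map_quadratic_eq_mul`; the two factors have the same order) — the T5s-RamM token `m` IS the socket's `m` (no halving, no doubling);
* §2 the two spellings of the tokens used across the (C) organs: `|μ| = exp(−2m) ↔ |μ| = |ϖE|^m` (`|ϖE| = exp(−2)`; ★ p857711 ∕ LH4-p06 bind the power form, (C-5c) the exp form)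
  and `|μ − ρμ| = exp(−(2jl + d_ρ)) ↔ |μ − ρμ| = |ϖE^{jl}·(ϖM − ρϖM)|` (ρ-datum `|ϖM − ρϖM| = |ϖM|^{d_ρ}`, `|ϖM| = exp(−1)`).
HONEST LABEL: HC_CM is proved only modulo the 7 printed citations (2 remaining named inputs: hLiu418 = stmt-HodgeConjecture-24832, h413 = stmt-HodgeConjecture-24833) until rung 0
closes; (ρ2b′-X) :418 is an OPEN prover target — this file is a helper (`--supports`), proofs only; nothing printed is asserted.

## References
* [Rogawski1990] J. D. Rogawski, *Automorphic Representations of Unitary Groups in Three Variables*, Ann. of Math. Stud. 123 (1990), §4.9 p. 55, Lemma 4.9.3 p. 56 (the tokens of a type-(2) element).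
* [Serre1979] J.-P. Serre, *Local Fields*, GTM 67 (1979): Ch. II §2 (valuations in a totally ramified extension).
-/

set_option autoImplicit false

noncomputable section

open scoped Valued
open WithZero
open Literature.NumberTheory.Automorphic.UnitaryThreeFourFrame (IsRamifiedQuadraticDatum)
open Summit.HodgeConjecture.HodgeConjecture.Cruxes.H413.F0P3cDyRamTypeTwoDepthDictionary (map_quadratic_eq_mul eq_exp_neg_of_mul_self_eq)

namespace Summit.HodgeConjecture.HodgeConjecture.Cruxes.H413.F0P3cDyRamTokenLettersRamM

variable {E : Type} {M : Type} [Field E] [Valued E ℤᵐ⁰] [Field M] [Valued M ℤᵐ⁰] {ρ : M →+* M}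

/-! ## §1 The depth dictionary on the ramified line -/

/-- **THE DEPTH DICTIONARY, TYPE RamM: `|λ − ι u₀| = exp(−2m)`.**  With `ι` DOUBLING orders (`|ι x| = |x|²`), `ρ` isometric and fixing `ι(E)`, the eigen-package letters
`ρλ = ι t − λ`, `λ² = ι t·λ − ι D`, and the m-token `|u₀² − t·u₀ + D| = exp(−2m)`: `|λ − ι u₀| = exp(−2m)` — the letter `hm` of (C-5c) `realizable_of_frame_ramM` and (power form, §2)
of ★ p857711 ∕ LH4-p06's heads. [cite: Rogawski1990, §4.9 p. 55, Lemma 4.9.3 p. 56] [cite: Serre1979, Ch. II §2] -/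
theorem v_sub_eq_exp_of_token_ramM (jE : E →+* M) (hjE2 : ∀ x, Valued.v (jE x) = Valued.v x ^ 2)
    (hvρ : ∀ x, Valued.v (ρ x) = Valued.v x) (hjfix : ∀ z, ρ z = z ↔ ∃ c, jE c = z)
    {lam : M} {t D : E} (hρlam : ρ lam = jE t - lam) (hlam2 : lam * lam = jE t * lam - jE D)
    (u₀ : E) {m : ℕ} (htok : Valued.v (u₀ ^ 2 - t * u₀ + D) = exp (-(2 * (m : ℤ)))) :
    Valued.v (lam - jE u₀) = exp (-(2 * (m : ℤ))) := by
  have hρu : ρ (jE u₀) = jE u₀ := (hjfix _).2 ⟨u₀, rfl⟩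
  have hconj : jE u₀ - ρ lam = ρ (jE u₀ - lam) := by rw [map_sub, hρu]
  have hprod : Valued.v (jE u₀ - lam) * Valued.v (jE u₀ - lam) = exp (-(2 * (2 * (m : ℤ)))) := by
    have h1 : Valued.v (jE (u₀ ^ 2 - t * u₀ + D)) = Valued.v (jE u₀ - lam) * Valued.v (jE u₀ - lam) := by
      rw [map_quadratic_eq_mul jE hρlam hlam2 u₀, map_mul, hconj, hvρ]
    rw [← h1, hjE2, htok, sq, ← exp_add]; congr 1; ring
  rw [Valuation.map_sub_swap]
  have h := eq_exp_neg_of_mul_self_eq (m := 2 * m) (by rw [hprod]; push_cast; ring_nf)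
  rw [h]; push_cast; ring_nf

/-! ## §2 The two spellings of the tokens -/

/-- `|μ| = exp(−2m) ↔ |μ| = |ϖE|^m` for `|ϖE| = exp(−2)`. [cite: Serre1979, Ch. II §2] -/
theorem v_eq_exp_iff_v_eq_pow {ϖE μ : M} (hϖE : Valued.v ϖE = exp (-2 : ℤ)) (m : ℕ) :
    Valued.v μ = exp (-(2 * (m : ℤ))) ↔ Valued.v μ = Valued.v ϖE ^ m := by
  rw [hϖE, ← exp_nsmul, nsmul_eq_mul]
  constructor <;> intro h <;> rw [h] <;> congr 1 <;> ring

/-- `|μ − ρμ| = exp(−(2jl + d_ρ)) ↔ |μ − ρμ| = |ϖE^{jl}·(ϖM − ρϖM)|` for `|ϖE| = exp(−2)` and the ρ-datum at the uniformiser `ϖM` (`|ϖM − ρϖM| = |ϖM|^{d_ρ}`, `|ϖM| = exp(−1)`).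
[cite: Serre1979, Ch. II §2] -/
theorem v_eq_exp_iff_v_eq_pow_mul {ϖE ϖM x : M} {dρ t : ℕ} (hϖE : Valued.v ϖE = exp (-2 : ℤ)) (hD : IsRamifiedQuadraticDatum ρ ϖM dρ t) (jl : ℕ) :
    Valued.v x = exp (-(2 * (jl : ℤ) + dρ)) ↔ Valued.v x = Valued.v (ϖE ^ jl * (ϖM - ρ ϖM)) := by
  obtain ⟨-, -, hϖM, -, hdd, -, -⟩ := hD
  have : Valued.v (ϖE ^ jl * (ϖM - ρ ϖM)) = exp (-(2 * (jl : ℤ) + dρ)) := by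
    rw [map_mul, map_pow, hϖE, hdd, hϖM, ← exp_nsmul, ← exp_nsmul, ← exp_add, nsmul_eq_mul, nsmul_eq_mul]
    congr 1; ring
  rw [this]

/-- The two token letters of (C-5c) from the power-form letters of ★ p857711 ∕ LH4-p06 (`hμ : |μ| = |ϖE|^m`, `hjl : |μ − ρμ| = |ϖE^{jl}(ϖM − ρϖM)|`).
[cite: Rogawski1990, §4.9 p. 55, Lemma 4.9.3 p. 56] -/
theorem tokens_exp_of_pow {ϖE ϖM μ : M} {dρ t : ℕ} (hϖE : Valued.v ϖE = exp (-2 : ℤ)) (hD : IsRamifiedQuadraticDatum ρ ϖM dρ t)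
    {m jl : ℕ} (hμ : Valued.v μ = Valued.v ϖE ^ m) (hjl : Valued.v (μ - ρ μ) = Valued.v (ϖE ^ jl * (ϖM - ρ ϖM))) :
    Valued.v μ = exp (-(2 * (m : ℤ))) ∧ Valued.v (μ - ρ μ) = exp (-(2 * (jl : ℤ) + dρ)) :=
  ⟨(v_eq_exp_iff_v_eq_pow hϖE m).2 hμ, (v_eq_exp_iff_v_eq_pow_mul hϖE hD jl).2 hjl⟩

/-- … and conversely. [cite: Rogawski1990, §4.9 p. 55, Lemma 4.9.3 p. 56] -/
theorem tokens_pow_of_exp {ϖE ϖM μ : M} {dρ t : ℕ} (hϖE : Valued.v ϖE = exp (-2 : ℤ)) (hD : IsRamifiedQuadraticDatum ρ ϖM dρ t)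
    {m jl : ℕ} (hμ : Valued.v μ = exp (-(2 * (m : ℤ)))) (hjl : Valued.v (μ - ρ μ) = exp (-(2 * (jl : ℤ) + dρ))) :
    Valued.v μ = Valued.v ϖE ^ m ∧ Valued.v (μ - ρ μ) = Valued.v (ϖE ^ jl * (ϖM - ρ ϖM)) :=
  ⟨(v_eq_exp_iff_v_eq_pow hϖE m).1 hμ, (v_eq_exp_iff_v_eq_pow_mul hϖE hD jl).1 hjl⟩

end Summit.HodgeConjecture.HodgeConjecture.Cruxes.H413.F0P3cDyRamTokenLettersRamM

end
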